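import Summits.CriticalPhenomena.SAWScalingLimit.Theses.SAWMassiveIsingTilt
import Summits.CriticalPhenomena.SAWScalingLimit.Theorems.SAWMassiveIsingTiltDefs
import Literature.Probability.RandomPlanarGeometry.ConformalRestrictionHolds
import Literature.Probability.RandomPlanarGeometry.ConformalRestrictionLocal
import Literature.Probability.RandomPlanarGeometry.HullRestrictionSLEHolds
import Literature.Probability.RandomPlanarGeometry.CritPercSLESimplePathHolds
import Literature.Probability.RandomPlanarGeometry.SLEExistenceNeEightHolds
import Literature.Probability.RandomPlanarGeometry.SLEUniquenessInLaw
import HarnessLib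

/-!
# Crux `MassiveWindowSLE` (stmt-CriticalPhenomena-7685), line `registered` (skeleton r5):
stub `stub_massiveWindowSLE_of_windowLSWFamily` — identification glue, and the logical geometry of the crux

Route `SAWMassiveIsingTilt` of `CriticalPhenomena/SAWScalingLimit`; lead prover c2 of the line
`registered` (skeleton `Cruxes/MassiveWindowSLE/Lines/birth.lean`, r5). Objects: the named tilted
interface law `tiltLaw` of `Theorems/SAWMassiveIsingTiltDefs.lean` (the route file's `let tiltLaw`,
definitionally), the window laws `tiltLaw D.carrier δ (x δ) (1/√3 − m δ·δ) (a δ) (b δ)`.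

This file PROVES (sorry-free, standard axioms):

* `convergesInLawToSLE_eightThirds_of_tendstoLaw` — a lattice model whose interfaces converge in law
  (`TendstoLaw`, bounded continuous test functions along `𝓝[>] 0`) to the law `Q D` of a chordal
  family `Q` satisfying the four Lawler–Schramm–Werner axioms (chordal, conformally covariant,
  two-sided restriction over hull subdomains, carried by simple curves) converges in law to chordal
  SLE_{8/3}: [LSW03] p. 5 result 2 in hull form, PROVED in the tree
  (`LawlerSchrammWerner2003_unique_holds`, `ChordalFamily.spec_of_isSLELaw_eightThirds`,
  `IsSLELaw.hullRestriction_eightThirds_holds`, `ae_isSimpleTrace_sleTrace_of_le_four_holds`,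
  `exists_isSLECurve_eightThirds`), plus `integral_map`;
* `stub_massiveWindowSLE_of_windowLSWFamily` — the registered stub T of skeleton r5: a window
  schedule (`m → +∞`, `m δ·δ → 0`) and tilt with a window-limit family satisfying the LSW axioms give
  the crux (read through `tiltLaw`; `Theorems.SAWMassiveIsingTilt.massiveWindowSLE_iff` is `Iff.rfl`);
* `windowLSWFamily_of_massiveWindowSLE` — the CONVERSE: under the crux the chordal SLE_{8/3} family
  is such a window-limit family (uniqueness in law of chordal SLE, the tree's PROVED
  `IsSLECurve.map_eq_holds`);
* `massiveWindowSLE_iff_windowLSWFamily` — hence the crux `MassiveWindowSLE` is EXACTLY "some window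
  schedule and tilt have a window-limit family with the four LSW axioms". The line's cut (existence +
  covariance + simplicity in stub 1, NoTouch and hull restriction produced on the lattice) therefore
  loses nothing, and NoTouch / hull restriction are NECESSARY properties of the window limit.

References: G. F. Lawler, O. Schramm, W. Werner, *Conformal restriction: the chordal case*, J. Amer.
Math. Soc. 16 (2003) 917–955, p. 5 result 2 (with Prop. 3.3, Thm. 6.1, Cor. 8.6); S. Rohde,
O. Schramm, *Basic properties of SLE*, Ann. of Math. 161 (2005), Thm. 5.1, 6.1, 7.1.
-/

noncomputable section

namespace Summit.CriticalPhenomena.SAWScalingLimit.Theorems.MassiveWindowSLE.Birth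

open scoped Topology NNReal ENNReal
open Filter Set MeasureTheory
open Literature.Probability Literature.Probability.LatticeModels
  Literature.Probability.RandomPlanarGeometry
open Summit.CriticalPhenomena.SAWScalingLimit.Theorems.SAWMassiveIsingTilt (tiltLaw massiveWindowSLE_iff)

/-! ### LSW identification of a limit family, read back on any lattice model -/

/-- **A limit family with the LSW axioms is chordal SLE_{8/3}, on the lattice.** If the interfaces
`X δ` under the laws `μ δ` converge in law along `𝓝[>] 0` to the law `Q D` of a chordal family `Q`
that is chordal, conformally covariant, has two-sided restriction over hull subdomains and is
carried by simple curves, and are eventually a.e.-measurable, then they converge in law to chordal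
SLE_{8/3} in `D` ([LSW03] p. 5 result 2, hull form, proved in the tree, + `integral_map`). -/
theorem convergesInLawToSLE_eightThirds_of_tendstoLaw {Ωδ : ℝ → Type*}
    [∀ δ, MeasurableSpace (Ωδ δ)] {X : ∀ δ, Ωδ δ → CurveClass ℂ} {μ : ∀ δ, Measure (Ωδ δ)}
    {Q : ChordalFamily} (hQc : Q.IsChordal) (hQcov : Q.IsConformallyCovariant)
    (hQres : Q.IsHullRestriction) (hQs : Q.IsCarriedBySimpleCurves) (D : DobrushinDomain)
    (hX : ∀ᶠ δ in 𝓝[>] (0 : ℝ), AEMeasurable (X δ) (μ δ)) (hlim : TendstoLaw X μ id (Q D)) :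
    ConvergesInLawToSLE ((8 : ℝ≥0) / 3) D X μ := by
  -- `Q D` is the chordal SLE_{8/3} law of `D` (LSW 2003, p. 5 result 2, hull form)
  have hLSW : IsSLELaw ((8 : ℝ≥0) / 3) D (Q D) := by
    choose Γ hΓ using exists_isSLECurve_eightThirds
    have hQ' : ∀ D : DobrushinDomain,
        IsSLELaw ((8 : ℝ≥0) / 3) D ((fun D' => Process.preWienerMeasure.map (Γ D')) D) :=
      fun D => (hΓ D).isSLELaw_map
    obtain ⟨h1, h2, h3, h4⟩ := ChordalFamily.spec_of_isSLELaw_eightThirds hQ'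
      IsSLELaw.hullRestriction_eightThirds_holds ae_isSimpleTrace_sleTrace_of_le_four_holds
    rw [LawlerSchrammWerner2003_unique_holds Q _ hQc hQcov hQres hQs h1 h2 h3 h4 D]
    exact hQ' D
  obtain ⟨Γ, hΓ, hQD⟩ := hLSW
  refine ⟨Γ, hΓ, hX, fun f => ?_⟩
  have h := hlim f
  simp only [id_eq] at h
  rw [hQD, integral_map hΓ.aemeasurable f.continuous.aestronglyMeasurable] at h
  exact h

/-! ### Stub T of skeleton r5 -/

/-- **Stub T (`stub_massiveWindowSLE_of_windowLSWFamily`, registered on stmt-CriticalPhenomena-7685):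
a window-limit family with the LSW axioms gives the crux.** If some window schedule (`m → +∞`,
`m δ · δ → 0`) and tilt `x` have a window-limit family `P` — the tilted interface laws
`tiltLaw D.carrier δ (x δ) (1/√3 − m δ·δ) (a δ) (b δ)`, pushed to curve classes, converge weakly to
`P D` in every Dobrushin domain along every hexagonal endpoint approximation — which is chordal,
conformally covariant, has two-sided restriction over hull subdomains and is carried by simple
curves, then the window laws converge in law to chordal SLE_{8/3} (the crux `MassiveWindowSLE` read
through `tiltLaw`, `massiveWindowSLE_iff`). Measurability is automatic on the discrete space of
walks. -/
theorem stub_massiveWindowSLE_of_windowLSWFamily :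
    (∃ (m x : ℝ → ℝ) (P : Literature.Probability.RandomPlanarGeometry.ChordalFamily), Filter.Tendsto m (nhdsWithin 0 (Set.Ioi 0)) Filter.atTop ∧ Filter.Tendsto (fun δ => m δ * δ) (nhdsWithin 0 (Set.Ioi 0)) (nhds 0) ∧ (∀ (D : Literature.Probability.RandomPlanarGeometry.DobrushinDomain) (a b : ℝ → Literature.Probability.LatticeModels.HexVertex), Literature.Probability.RandomPlanarGeometry.SAW.IsEmbEndpointApprox Literature.Probability.LatticeModels.hexGraph Literature.Probability.LatticeModels.hexCenter D a b → Literature.Probability.RandomPlanarGeometry.TendstoLaw (fun δ (γ : Literature.Probability.RandomPlanarGeometry.SAW.HexDomainSAW D.carrier δ (a δ) (b δ)) => γ.curve) (fun δ => Summit.CriticalPhenomena.SAWScalingLimit.Theorems.SAWMassiveIsingTilt.tiltLaw D.carrier δ (x δ) ((Real.sqrt 3)⁻¹ - m δ * δ) (a δ) (b δ)) id (P D)) ∧ P.IsChordal ∧ P.IsConformallyCovariant ∧ P.IsHullRestriction ∧ P.IsCarriedBySimpleCurves) → ∃ m x : ℝ → ℝ, Filter.Tendsto m (nhdsWithin 0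 (Set.Ioi 0)) Filter.atTop ∧ Filter.Tendsto (fun δ => m δ * δ) (nhdsWithin 0 (Set.Ioi 0)) (nhds 0) ∧ ∀ (D : Literature.Probability.RandomPlanarGeometry.DobrushinDomain) (a b : ℝ → Literature.Probability.LatticeModels.HexVertex), Literature.Probability.RandomPlanarGeometry.SAW.IsEmbEndpointApprox Literature.Probability.LatticeModels.hexGraph Literature.Probability.LatticeModels.hexCenter D a b → Literature.Probability.RandomPlanarGeometry.ConvergesInLawToSLE ((8 : NNReal) / 3) D (fun δ (γ : Literature.Probability.RandomPlanarGeometry.SAW.HexDomainSAW D.carrier δ (a δ) (b δ)) => γ.curve) (fun δ => Summit.CriticalPhenomena.SAWScalingLimit.Theorems.SAWMassiveIsingTilt.tiltLaw D.carrier δ (x δ) ((Real.sqrt 3)⁻¹ - m δ * δ) (a δ) (b δ)) := by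
  rintro ⟨m, x, P, hm, hmδ, hlim, hP, hcov, hres, hS⟩
  exact ⟨m, x, hm, hmδ, fun D a b hab =>
    convergesInLawToSLE_eightThirds_of_tendstoLaw hP hcov hres hS D
      (Eventually.of_forall fun δ => (SAW.EmbDomainSAW.measurable_of_top _).aemeasurable)
      (hlim D a b hab)⟩

/-! ### The converse, and the logical geometry of the crux -/

/-- **Converse of stub T: under the crux, the chordal SLE_{8/3} family is a window-limit family with
the LSW axioms.** Choose an SLE_{8/3} curve `Γ D` in every Dobrushin domain
(`exists_isSLECurve_eightThirds`) and let `P D` be its law; `P` has the four LSW properties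
(`ChordalFamily.spec_of_isSLELaw_eightThirds`), and every `ConvergesInLawToSLE` clause of the crux is
weak convergence to `P D`, because two SLE_{8/3} curves of `D` have the same law
(`IsSLECurve.map_eq_holds`). -/
theorem windowLSWFamily_of_massiveWindowSLE
    (h : Summit.CriticalPhenomena.SAWScalingLimit.Theses.SAWMassiveIsingTilt.MassiveWindowSLE) :
    ∃ (m x : ℝ → ℝ) (P : Literature.Probability.RandomPlanarGeometry.ChordalFamily), Filter.Tendsto m (nhdsWithin 0 (Set.Ioi 0)) Filter.atTop ∧ Filter.Tendsto (fun δ => m δ * δ) (nhdsWithin 0 (Set.Ioi 0)) (nhds 0) ∧ (∀ (D : Literature.Probability.RandomPlanarGeometry.DobrushinDomain) (a b : ℝ → Literature.Probability.LatticeModels.HexVertex), Literature.Probability.RandomPlanarGeometry.SAW.IsEmbEndpointApprox Literature.Probability.LatticeModels.hexGraph Literature.Probability.LatticeModels.hexCenter D a b → Literature.Probability.RandomPlanarGeometry.TendstoLaw (fun δ (γ : Literature.Probability.RandomPlanarGeometry.SAW.HexDomainSAW D.carrier δ (a δ) (b δ)) => γ.curve) (fun δ => Summit.CriticalPhenomena.SAWScalingLimit.Theorems.SAWMassiveIsingTilt.tiltLaw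 D.carrier δ (x δ) ((Real.sqrt 3)⁻¹ - m δ * δ) (a δ) (b δ)) id (P D)) ∧ P.IsChordal ∧ P.IsConformallyCovariant ∧ P.IsHullRestriction ∧ P.IsCarriedBySimpleCurves := by
  obtain ⟨m, x, hm, hmδ, hconv⟩ := massiveWindowSLE_iff.1 h
  choose Γ hΓ using exists_isSLECurve_eightThirds
  have hQ : ∀ D : DobrushinDomain,
      IsSLELaw ((8 : ℝ≥0) / 3) D ((fun D' => Process.preWienerMeasure.map (Γ D')) D) :=
    fun D => (hΓ D).isSLELaw_map
  obtain ⟨h1, h2, h3, h4⟩ := ChordalFamily.spec_of_isSLELaw_eightThirds hQ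
    IsSLELaw.hullRestriction_eightThirds_holds ae_isSimpleTrace_sleTrace_of_le_four_holds
  refine ⟨m, x, fun D' => Process.preWienerMeasure.map (Γ D'), hm, hmδ, ?_, h1, h2, h3, h4⟩
  intro D a b hab f
  obtain ⟨Γ', hΓ', -, hT⟩ := hconv D a b hab
  have key : (∫ ω, f (Γ' ω) ∂Process.preWienerMeasure) =
      ∫ c, f (id c) ∂((fun D' => Process.preWienerMeasure.map (Γ D')) D) := by
    simp only [id_eq]
    rw [← IsSLECurve.map_eq_holds hΓ' (hΓ D),
      integral_map hΓ'.aemeasurable f.continuous.aestronglyMeasurable]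
  simpa only [key] using hT f

/-- **The logical geometry of the crux.** `MassiveWindowSLE` holds iff some window schedule
(`m → +∞`, `m δ·δ → 0`) and tilt have a window-limit family satisfying the four LSW axioms. In
particular NoTouch and two-sided hull restriction of the window limit — the conclusions the line
produces on the lattice — are necessary, and stub 1 of the line (existence + covariance + simplicity
along a fast schedule) is the crux minus restriction. -/
theorem massiveWindowSLE_iff_windowLSWFamily :
    Summit.CriticalPhenomena.SAWScalingLimit.Theses.SAWMassiveIsingTilt.MassiveWindowSLE ↔
      ∃ (m x : ℝ → ℝ) (P : Literature.Probability.RandomPlanarGeometry.ChordalFamily), Filter.Tendsto m (nhdsWithin 0 (Set.Ioi 0)) Filter.atTop ∧ Filter.Tendsto (fun δ => m δ * δ) (nhdsWithin 0 (Set.Ioi 0)) (nhds 0) ∧ (∀ (D : Literature.Probability.RandomPlanarGeometry.DobrushinDomain) (a b : ℝ → Literature.Probability.LatticeModels.HexVertex), Literature.Probability.RandomPlanarGeometry.SAW.IsEmbEndpointApprox Literature.Probability.LatticeModels.hexGraph Literature.Probability.LatticeModels.hexCenter D a b → Literature.Probability.RandomPlanarGeometry.TendstoLaw (fun δ (γ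 : Literature.Probability.RandomPlanarGeometry.SAW.HexDomainSAW D.carrier δ (a δ) (b δ)) => γ.curve) (fun δ => Summit.CriticalPhenomena.SAWScalingLimit.Theorems.SAWMassiveIsingTilt.tiltLaw D.carrier δ (x δ) ((Real.sqrt 3)⁻¹ - m δ * δ) (a δ) (b δ)) id (P D)) ∧ P.IsChordal ∧ P.IsConformallyCovariant ∧ P.IsHullRestriction ∧ P.IsCarriedBySimpleCurves :=
  ⟨windowLSWFamily_of_massiveWindowSLE, fun h =>
    massiveWindowSLE_iff.2 (stub_massiveWindowSLE_of_windowLSWFamily h)⟩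

end Summit.CriticalPhenomena.SAWScalingLimit.Theorems.MassiveWindowSLE.Birth

end
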